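import Summits.KontsevichZagierPeriods.KontsevichZagierPeriods.Theorems.LinRedNormalFormHoffmanIndependenceRungs
import Summits.KontsevichZagierPeriods.KontsevichZagierPeriods.Theorems.LinRedNormalFormHoffmanIndependenceZagierEquivalence

/-!
# Crux `HoffmanIndependence` (stmt-KontsevichZagierPeriods-15045), line `weight_split` —
# the truncation of the crux at weight `≤ 5`, typed in classical coordinates

The crux is the `ℚ`-linear independence of ALL real Hoffman values `ζ(u)`, `u ∈ {2,3}^×`. Its
truncation at weight `≤ 5` is the family indexed by the six Hoffman words of weight `≤ 5`:
`∅, (2), (3), (2,2), (3,2), (2,3)` (`eq_of_isHoffman_of_weight_le_five`), with values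
`1, ζ(2) = π²/6, ζ(3), ζ(2,2) = π⁴/120, ζ(3,2) = 3ζ(2)ζ(3) − (11/2)ζ(5), ζ(2,3) = (9/2)ζ(5) − 2ζ(2)ζ(3)`
(tree theorems `multipleZeta_nil`, `multipleZeta_two`, `multipleZeta_two_two`,
`multipleZeta_three_two_eq`, `multipleZeta_two_three_eq`). Hence the six values and the six
classical numbers `1, π², ζ(3), π⁴, ζ(5), π²ζ(3)` span the SAME `ℚ`-subspace of `ℝ`
(`span_hoffmanLeFive_eq`: a rational change of coordinates, the weight-5 block having determinant
`5/2`), so one 6-tuple is independent iff the other is (`truncation_five_iff`: both say that this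
common span has dimension `6`). This is the first JOINT open rung of the crux (weights `≤ 4` reduce
to `ζ(3) ∉ ℚ + ℚπ² + ℚπ⁴`; weight `5` brings in `ζ(5)`). Nothing here closes the item; no new
definitions. [cite: Zagier1994, §9]
-/

noncomputable section

namespace Summit.KontsevichZagierPeriods.LinRedNormalForm.HoffmanIndependence

open Literature.NumberTheory.Transcendental MZV

/-- A Hoffman word of weight `≤ 5` is one of `∅, (2), (3), (2,2), (3,2), (2,3)`. [folklore] -/
theorem eq_of_isHoffman_of_weight_le_five {u : List ℕ} (hu : IsHoffman u) (hw : weight u ≤ 5) :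
    u = [] ∨ u = [2] ∨ u = [3] ∨ u = [2, 2] ∨ u = [3, 2] ∨ u = [2, 3] := by
  rcases u with _ | ⟨a, _ | ⟨b, _ | ⟨c, t⟩⟩⟩
  · exact Or.inl rfl
  · rcases hu a (by simp) with rfl | rfl
    · exact Or.inr (Or.inl rfl)
    · exact Or.inr (Or.inr (Or.inl rfl))
  · have ha := hu a (by simp)
    have hb := hu b (by simp)
    simp only [weight, List.sum_cons, List.sum_nil] at hw
    rcases ha with rfl | rfl <;> rcases hb with rfl | rfl
    · exact Or.inr (Or.inr (Or.inr (Or.inl rfl)))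
    · exact Or.inr (Or.inr (Or.inr (Or.inr (Or.inr rfl))))
    · exact Or.inr (Or.inr (Or.inr (Or.inr (Or.inl rfl))))
    · omega
  · exfalso
    have ha := hu a (by simp)
    have hb := hu b (by simp)
    have hc := hu c (by simp)
    simp only [weight, List.sum_cons] at hw
    omega

/-- The six Hoffman words of weight `≤ 5`, as an explicit bijection with `Fin 6`. [folklore] -/
theorem hoffmanLeFive_bijective :
    Function.Bijective
      (![⟨[], by decide, by decide⟩, ⟨[2], by decide, by decide⟩, ⟨[3], by decide, by decide⟩,
          ⟨[2, 2], by decide, by decide⟩, ⟨[3, 2], by decide, by decide⟩,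
          ⟨[2, 3], by decide, by decide⟩] :
        Fin 6 → {u : List ℕ // IsHoffman u ∧ weight u ≤ 5}) := by
  refine ⟨fun i j hij => ?_, fun u => ?_⟩
  · fin_cases i <;> fin_cases j <;> simp_all
  · rcases u with ⟨u, hu, hw⟩
    rcases eq_of_isHoffman_of_weight_le_five hu hw with rfl | rfl | rfl | rfl | rfl | rfl
    · exact ⟨0, rfl⟩
    · exact ⟨1, rfl⟩
    · exact ⟨2, rfl⟩
    · exact ⟨3, rfl⟩
    · exact ⟨4, rfl⟩
    · exact ⟨5, rfl⟩

/-- The six Hoffman values of weight `≤ 5` and the six classical numbers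
`1, π², ζ(3), π⁴, ζ(5), π²ζ(3)` span the same `ℚ`-subspace of `ℝ`: `ζ(∅) = 1`, `ζ(2) = π²/6`,
`ζ(2,2) = π⁴/120`, and the weight-5 double shuffle evaluations
`ζ(3,2) = (1/2)π²ζ(3) − (11/2)ζ(5)`, `ζ(2,3) = (9/2)ζ(5) − (1/3)π²ζ(3)` with inverse
`ζ(5) = (4/5)ζ(3,2) + (6/5)ζ(2,3)`, `π²ζ(3) = (54/5)ζ(3,2) + (66/5)ζ(2,3)`. [cite: Zagier1994, §9] -/
theorem span_hoffmanLeFive_eq :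
    Submodule.span ℚ (Set.range ![(1 : ℝ), Real.pi ^ 2, multipleZeta [3], Real.pi ^ 4,
        multipleZeta [5], Real.pi ^ 2 * multipleZeta [3]]) =
      Submodule.span ℚ (Set.range ![multipleZeta [], multipleZeta [2], multipleZeta [3],
        multipleZeta [2, 2], multipleZeta [3, 2], multipleZeta [2, 3]]) := by
  have h0 : multipleZeta [] = 1 := multipleZeta_nil
  have h2 : multipleZeta [2] = Real.pi ^ 2 / 6 := multipleZeta_two
  have h22 : multipleZeta [2, 2] = Real.pi ^ 4 / 120 := multipleZeta_two_two
  have h32 : multipleZeta [3, 2] =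
      3 * (multipleZeta [2] * multipleZeta [3]) - 11 / 2 * multipleZeta [5] :=
    multipleZeta_three_two_eq
  have h23 : multipleZeta [2, 3] =
      9 / 2 * multipleZeta [5] - 2 * (multipleZeta [2] * multipleZeta [3]) :=
    multipleZeta_two_three_eq
  rw [h2] at h32 h23
  refine le_antisymm (Submodule.span_le.2 (Set.range_subset_iff.2 fun i => ?_))
    (Submodule.span_le.2 (Set.range_subset_iff.2 fun i => ?_))
  · rw [SetLike.mem_coe, Submodule.mem_span_range_iff_exists_fun]
    fin_cases i
    · exact ⟨![1, 0, 0, 0, 0, 0], by simp [Fin.sum_univ_six, h0]⟩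
    · refine ⟨![0, 6, 0, 0, 0, 0], ?_⟩
      simp only [Fin.sum_univ_six, Matrix.cons_val, h2, Rat.smul_def]
      push_cast
      ring
    · exact ⟨![0, 0, 1, 0, 0, 0], by simp [Fin.sum_univ_six]⟩
    · refine ⟨![0, 0, 0, 120, 0, 0], ?_⟩
      simp only [Fin.sum_univ_six, Matrix.cons_val, h22, Rat.smul_def]
      push_cast
      ring
    · refine ⟨![0, 0, 0, 0, 4 / 5, 6 / 5], ?_⟩
      simp only [Fin.sum_univ_six, Matrix.cons_val, h32, h23, Rat.smul_def]
      push_cast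
      ring
    · refine ⟨![0, 0, 0, 0, 54 / 5, 66 / 5], ?_⟩
      simp only [Fin.sum_univ_six, Matrix.cons_val, h32, h23, Rat.smul_def]
      push_cast
      ring
  · rw [SetLike.mem_coe, Submodule.mem_span_range_iff_exists_fun]
    fin_cases i
    · exact ⟨![1, 0, 0, 0, 0, 0], by simp [Fin.sum_univ_six, h0]⟩
    · refine ⟨![0, 6⁻¹, 0, 0, 0, 0], ?_⟩
      simp only [Fin.sum_univ_six, Matrix.cons_val, h2, Rat.smul_def]
      push_cast
      ring
    · exact ⟨![0, 0, 1, 0, 0, 0], by simp [Fin.sum_univ_six]⟩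
    · refine ⟨![0, 0, 0, 120⁻¹, 0, 0], ?_⟩
      simp only [Fin.sum_univ_six, Matrix.cons_val, h22, Rat.smul_def]
      push_cast
      ring
    · refine ⟨![0, 0, 0, 0, -(11 / 2), 2⁻¹], ?_⟩
      simp only [Fin.sum_univ_six, Matrix.cons_val, h32, Rat.smul_def]
      push_cast
      ring
    · refine ⟨![0, 0, 0, 0, 9 / 2, -3⁻¹], ?_⟩
      simp only [Fin.sum_univ_six, Matrix.cons_val, h23, Rat.smul_def]
      push_cast
      ring

/-- **The truncation of the crux at weight `≤ 5`, typed.** The six real Hoffman values of weight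
`≤ 5` — `ζ(∅) = 1, ζ(2), ζ(3), ζ(2,2), ζ(3,2), ζ(2,3)` — are `ℚ`-linearly independent iff the six
classical numbers `1, π², ζ(3), π⁴, ζ(5), π²ζ(3)` are: the two 6-tuples span the same `ℚ`-subspace
of `ℝ` (`span_hoffmanLeFive_eq`), and `d` vectors spanning a space `V` are independent iff
`d ≤ dim_ℚ V` (`linearIndependent_iff_le_finrank_of_eq_span`). This is the first joint open rung of
the crux `HoffmanIndependence`: weights `≤ 4` amount to `ζ(3) ∉ ℚ + ℚπ² + ℚπ⁴`, weight `5` brings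
in `ζ(5)`. [cite: Zagier1994, §9] -/
theorem truncation_five_iff : LinearIndependent ℚ (fun u : {u : List ℕ // IsHoffman u ∧ weight u ≤ 5} => multipleZeta u.1) ↔ LinearIndependent ℚ ![(1 : ℝ), Real.pi ^ 2, multipleZeta [3], Real.pi ^ 4, multipleZeta [5], Real.pi ^ 2 * multipleZeta [3]] := by
  rw [← linearIndependent_equiv (Equiv.ofBijective _ hoffmanLeFive_bijective)]
  have hfam : (fun u : {u : List ℕ // IsHoffman u ∧ weight u ≤ 5} => multipleZeta u.1) ∘
      (Equiv.ofBijective _ hoffmanLeFive_bijective) =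
        ![multipleZeta [], multipleZeta [2], multipleZeta [3], multipleZeta [2, 2],
          multipleZeta [3, 2], multipleZeta [2, 3]] := by
    funext i
    fin_cases i <;> rfl
  rw [hfam, linearIndependent_iff_le_finrank_of_eq_span span_hoffmanLeFive_eq,
    ← linearIndependent_iff_le_finrank_of_eq_span rfl]

end Summit.KontsevichZagierPeriods.LinRedNormalForm.HoffmanIndependence
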